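import Literature.AlgebraicGeometry.RelativeSpec.GeometricQuotientRecognition
import Literature.AlgebraicGeometry.Morphisms.SectionsFpqcDescentChart
import Mathlib.AlgebraicGeometry.Morphisms.FlatMono
import Mathlib.AlgebraicGeometry.Morphisms.Etale
import Mathlib.RingTheory.TensorProduct.IncludeLeftSubRight
import Mathlib.FieldTheory.IsAlgClosed.AlgebraicClosure
import HarnessLib

/-!
# An affine étale `G`-cover with transitive fibres is a geometric quotient of its base
# (SGA 1, Exp. V, Prop. 2.6, converse direction; Mumford, *Abelian Varieties*, §7 Thm. p. 66)

Topic `Literature/AlgebraicGeometry/RelativeSpec`, namespace `Literature.AlgebraicGeometry.RelativeSpec.ActionOver`.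
THEOREMS ONLY; no definition, no named fact, no instance, no notation, no `sorry`.

Let a group `G` act on `X` over `Q` (★ `RelativeSpec.ActionOver p G`: automorphisms `g` of `X` with `g ≫ p = p`) where
`p : X → Q` is AFFINE, ÉTALE and SURJECTIVE, and suppose `G` is TRANSITIVE ON THE GEOMETRIC FIBRES of `p`: for `Ω`
algebraically closed, two `Ω`-valued points of `X` with the same image in `Q` differ by some `g ∈ G`.  Then `p` IS a geometric quotient of `X` by `G`
(★ `ActionOver.IsGeometricQuotient`, Mumford's (1) topological quotient and (2) `𝒪_Q ⥲ (p_*𝒪_X)^G`):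

* `isOpenImmersion_graph_of_etale` — the graph `γ_g = (1, g) : X → X ×_Q X` is an open immersion (a section of the étale
  `pr₁`; the proof of ★ `IsGeometricQuotient.isOpenImmersion_graph` without its quotient hypothesis);
* `exists_mem_range_graph_of_transitive` — the graphs COVER `X ×_Q X` («surjectif puisque `G` est transitif sur les fibres»);
* `eq_of_forall_appLE_eq_of_subset_iUnion_range` — sections of any scheme agreeing after pull-back along a jointly surjective
  family of open immersions are equal (sheaf locality);
* `appLE_fst_eq_appLE_snd_of_forall_act_eq` — hence a `G`-INVARIANT section `s ∈ Γ(X, p⁻¹V)` has EQUAL COFACES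
  `pr₁♯ s = pr₂♯ s` on `X ×_Q X` (`γ_g♯ pr₁♯ s = s`, `γ_g♯ pr₂♯ s = g♯ s = s`);
* `range_app_eq_setOf_forall_act_eq` — so, on every affine `V ⊆ Q`, `p♯ : Γ(Q, V) → Γ(X, p⁻¹V)` has image EXACTLY the
  `G`-invariants: faithfully flat descent of elements (Amitsur in degree `0`, Mathlib `Algebra.IsEffective.of_faithfullyFlat`)
  through `Γ(pr₁⁻¹p⁻¹V) = Γ(p⁻¹V) ⊗_{Γ(V)} Γ(p⁻¹V)` (★ `Morphisms.exists_ringEquiv_tensorProduct_kernelPair`) and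
  `Γ(V) → Γ(p⁻¹V)` faithfully flat (★ `Morphisms.faithfullyFlat_appLE`); `app_injective_of_flat_of_surjective` is injectivity;
* **`isGeometricQuotient_of_etale_of_transitive`** — THE HEAD: `σ.IsGeometricQuotient p`, by the recognition theorem
  ★ `ActionOver.isGeometricQuotient_of_range_app` on the affine opens of `Q`.

NO freeness is needed (SGA 1 V 2.6: transitivity gives «surjectif», étaleness «isomorphisme local»; «sans inertie» is only
used for the disjointness of the graphs, i.e. for the torsor property ★ `GeometricQuotientFreeTorsor`, which is the converse
direction).  Written for cell `hodgecm-mathlib` (F-3 (M) carrier package (Ma0): the level-`M`-basis cover of an abelian scheme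
is a free `GL_{2g}(ℤ/M)`-quotient presentation of its base); HC_CM is proved only modulo the 7 printed citations until rung 0
closes; nothing here is about HC.

Mathlib searched (pin): `IsOpenImmersion.of_flat_of_mono`, `Etale.of_comp`, `Etale.iff_flat_and_formallyUnramified`,
`Scheme.Hom.appLE_appIso_inv`, `Scheme.Hom.image_preimage_le`, `TopCat.Sheaf.eq_of_locally_eq'`, `Scheme.Hom.appLE_comp_appLE`,
`Scheme.Hom.appLE_map`, `Algebra.IsEffective.of_faithfullyFlat`, `Algebra.TensorProduct.includeLeftSubRight_apply`,
`iSup_affineOpens_eq_top`, `AlgebraicClosure` (all used); Mathlib has no quotients of schemes by finite groups.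

## References
* [SGA1] A. Grothendieck, *SGA 1*, Exp. V, Prop. 2.6 (i)–(iii), Déf. 2.7 (revêtement principal); Exp. VIII Thm. 1.1, Cor. 1.2.
* [MumfordAV1970] D. Mumford, *Abelian Varieties* (1970), §7, Theorem p. 66 ((1), (2)); §12.
* [StacksProject] The Stacks Project, Tag 023M (fpqc descent of sections).
* [Hartshorne1977] R. Hartshorne, *Algebraic Geometry*, GTM 52 (1977), II §1 (sheaves: the identity axiom).
-/

noncomputable section

universe u

open CategoryTheory Limits AlgebraicGeometry TopologicalSpace Opposite TensorProduct

namespace Literature.AlgebraicGeometry.RelativeSpec.ActionOver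

open Literature.AlgebraicGeometry.Morphisms

set_option backward.isDefEq.respectTransparency false

/-! ### §1 Sections agreeing along a jointly surjective family of open immersions are equal -/

/-- **Sheaf locality along open immersions**: if open immersions `fᵢ : Yᵢ → Z` jointly cover an open `W ⊆ Z` and two sections
`s, t ∈ Γ(Z, W)` have the same pull-backs `fᵢ♯ s = fᵢ♯ t ∈ Γ(Yᵢ, fᵢ⁻¹W)` for all `i`, then `s = t` (the pull-back along an open
immersion is restriction to its image followed by an isomorphism, Mathlib `Scheme.Hom.appLE_appIso_inv`; then the sheaf condition,
identity axiom, for the cover of `W` by the images `fᵢ(fᵢ⁻¹W)`).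
[cite: Hartshorne1977, II §1, Definition of a sheaf, condition (3) (p. 61)] [cite: StacksProject, Tag 023M] -/
theorem _root_.Literature.AlgebraicGeometry.RelativeSpec.eq_of_forall_appLE_eq_of_subset_iUnion_range {Z : Scheme.{u}}
    {ι : Type*} {Y : ι → Scheme.{u}} (f : ∀ i, Y i ⟶ Z) [∀ i, IsOpenImmersion (f i)] (W : Z.Opens)
    (hcov : (W : Set Z) ⊆ ⋃ i, Set.range (f i)) {s t : Γ(Z, W)}
    (h : ∀ i, (f i).appLE W ((f i) ⁻¹ᵁ W) le_rfl s = (f i).appLE W ((f i) ⁻¹ᵁ W) le_rfl t) : s = t := by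
  refine TopCat.Sheaf.eq_of_locally_eq' Z.sheaf (fun i => (f i) ''ᵁ ((f i) ⁻¹ᵁ W)) W
    (fun i => homOfLE ((f i).image_preimage_le W)) (fun z hz => ?_) s t (fun i => ?_)
  · obtain ⟨i, y, hy⟩ := Set.mem_iUnion.mp (hcov hz)
    refine Opens.mem_iSup.mpr ⟨i, ⟨y, ?_, hy⟩⟩
    change (f i) y ∈ (W : Set Z)
    rwa [hy]
  · have h' := congrArg ((f i).appIso ((f i) ⁻¹ᵁ W)).inv (h i)
    rw [← CommRingCat.comp_apply, ← CommRingCat.comp_apply, Scheme.Hom.appLE_appIso_inv] at h'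
    exact h'

/-! ### §2 The graphs `γ_g = (1, g) : X → X ×_Q X`: open immersions covering `X ×_Q X` -/

variable {X Q : Scheme.{u}} {p : X ⟶ Q} {G : Type*} [Group G] (σ : ActionOver p G)

/-- **The graph of `g` is an open immersion** `X → X ×_Q X` when `p` is étale: a section of the étale `pr₁`, hence étale
(`Etale.of_comp`) and a (split) monomorphism, hence an open immersion (Mathlib `IsOpenImmersion.of_flat_of_mono`).  (★
`IsGeometricQuotient.isOpenImmersion_graph` verbatim, minus its — unused — quotient hypothesis.)
[cite: SGA1, Exp. V Prop. 2.6 ((i) ⇒ (iii))] -/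
theorem isOpenImmersion_graph_of_etale [Etale p] (g : G) :
    IsOpenImmersion (pullback.lift (𝟙 X) (σ.aut g).hom (by rw [Category.id_comp, σ.aut_comp])) := by
  set γ := pullback.lift (𝟙 X) (σ.aut g).hom (by rw [Category.id_comp, σ.aut_comp]) with hγ
  have hsec : γ ≫ pullback.fst p p = 𝟙 X := pullback.lift_fst _ _ _
  haveI : Etale (γ ≫ pullback.fst p p) := by rw [hsec]; infer_instance
  haveI : Etale γ := Etale.of_comp γ (pullback.fst p p)
  haveI : IsSplitMono γ := IsSplitMono.mk' ⟨pullback.fst p p, hsec⟩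
  haveI : Flat γ := (Etale.iff_flat_and_formallyUnramified.mp inferInstance).1
  haveI : LocallyOfFinitePresentation γ := (Etale.iff_flat_and_formallyUnramified.mp inferInstance).2.2
  exact IsOpenImmersion.of_flat_of_mono γ

/-- **The graphs cover `X ×_Q X` when `G` is transitive on the geometric fibres of `p`**: a point `z` of `X ×_Q X` gives
two geometric points `z̄ ≫ pr₁`, `z̄ ≫ pr₂` of `X` (`z̄ : Spec κ(z)^alg → X ×_Q X` through `z`) over the same point of `Q`, which differ
by some `g`, so `z = γ_g(z̄ ≫ pr₁)`.
(The proof of ★ `IsGeometricQuotient.iUnion_range_graph_eq_univ_of_free` with transitivity as the hypothesis.)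
[cite: SGA1, Exp. V Prop. 2.6 ((i) ⇒ (iii): «surjectif puisque `G` est transitif sur les fibres»)] -/
theorem exists_mem_range_graph_of_transitive
    (htrans : ∀ (Ω : Type u) [Field Ω] [IsAlgClosed Ω] (x₁ x₂ : Spec (.of Ω) ⟶ X), x₁ ≫ p = x₂ ≫ p →
      ∃ g : G, x₂ = x₁ ≫ (σ.aut g).hom)
    (z : ↑(pullback p p)) :
    ∃ g : G, z ∈ Set.range (pullback.lift (𝟙 X) (σ.aut g).hom (by rw [Category.id_comp, σ.aut_comp])) := by
  -- a geometric point `t : Spec Ω → X ×_Q X` through `z` (`Ω` an algebraic closure of `κ(z)`)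
  let Ω : Type u := AlgebraicClosure ((pullback p p).residueField z)
  let t : Spec (.of Ω) ⟶ pullback p p :=
    Spec.map (CommRingCat.ofHom (algebraMap ((pullback p p).residueField z) Ω)) ≫
      (pullback p p).fromSpecResidueField z
  obtain ⟨g, hg⟩ := htrans Ω (t ≫ pullback.fst p p) (t ≫ pullback.snd p p)
    (by simp only [t, Category.assoc, pullback.condition])
  refine ⟨g, (t ≫ pullback.fst p p) (IsLocalRing.closedPoint _), ?_⟩
  have ht : (t ≫ pullback.fst p p) ≫
      pullback.lift (𝟙 X) (σ.aut g).hom (by rw [Category.id_comp, σ.aut_comp]) = t := by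
    apply pullback.hom_ext
    · rw [Category.assoc, pullback.lift_fst, Category.comp_id]
    · rw [Category.assoc, pullback.lift_snd, hg]
  rw [← Scheme.Hom.comp_apply, ht, Scheme.Hom.comp_apply]
  exact Scheme.fromSpecResidueField_apply z _

/-! ### §3 Invariant sections have equal cofaces on `X ×_Q X` -/

/-- `appLE` along equal morphisms (the proof slots are irrelevant). [folklore] -/
private theorem appLE_congr_hom {Y Z : Scheme.{u}} {f₁ f₂ : Y ⟶ Z} (hf : f₁ = f₂) (U : Z.Opens) (W : Y.Opens)
    (e₁ : W ≤ f₁ ⁻¹ᵁ U) (e₂ : W ≤ f₂ ⁻¹ᵁ U) : f₁.appLE U W e₁ = f₂.appLE U W e₂ := by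
  subst hf
  rfl

/-- The action through `appLE` on `p⁻¹V`: `g♯ = act g⁻¹` (★ `ActionOver.act` is `(aut g⁻¹)♯`). [folklore] -/
private theorem appLE_aut_hom_eq_act_inv (g : G) (V : Q.Opens) (e : p ⁻¹ᵁ V ≤ (σ.aut g).hom ⁻¹ᵁ (p ⁻¹ᵁ V))
    (s : Γ(X, p ⁻¹ᵁ V)) : (σ.aut g).hom.appLE (p ⁻¹ᵁ V) (p ⁻¹ᵁ V) e s = σ.act g⁻¹ V s := by
  have h : (σ.aut g⁻¹⁻¹).hom = (σ.aut g).hom := by rw [inv_inv]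
  rw [act_apply, appLE_congr_hom h (p ⁻¹ᵁ V) (p ⁻¹ᵁ V) _ e]

/-- **A `G`-invariant section has equal cofaces**: for `p` étale with `G` transitive on geometric (algebraically-closed-field-valued) fibres and
`s ∈ Γ(X, p⁻¹V)` with `act g s = s` for all `g`, the two pull-backs `pr₁♯ s`, `pr₂♯ s ∈ Γ(X ×_Q X, pr₁⁻¹p⁻¹V ∩ pr₂⁻¹p⁻¹V)`
coincide — test along the covering open immersions `γ_g` (§2, §1): `γ_g♯ pr₁♯ s = s` and `γ_g♯ pr₂♯ s = g♯ s = s`.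
[cite: SGA1, Exp. V Prop. 2.6] [cite: StacksProject, Tag 023M] -/
theorem appLE_fst_eq_appLE_snd_of_forall_act_eq [Etale p]
    (htrans : ∀ (Ω : Type u) [Field Ω] [IsAlgClosed Ω] (x₁ x₂ : Spec (.of Ω) ⟶ X), x₁ ≫ p = x₂ ≫ p →
      ∃ g : G, x₂ = x₁ ≫ (σ.aut g).hom)
    (V : Q.Opens) (s : Γ(X, p ⁻¹ᵁ V)) (hs : ∀ g : G, σ.act g V s = s) :
    (pullback.fst p p).appLE (p ⁻¹ᵁ V)
        (pullback.fst p p ⁻¹ᵁ (p ⁻¹ᵁ V) ⊓ pullback.snd p p ⁻¹ᵁ (p ⁻¹ᵁ V)) inf_le_left s =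
      (pullback.snd p p).appLE (p ⁻¹ᵁ V)
        (pullback.fst p p ⁻¹ᵁ (p ⁻¹ᵁ V) ⊓ pullback.snd p p ⁻¹ᵁ (p ⁻¹ᵁ V)) inf_le_right s := by
  -- notation
  set U : X.Opens := p ⁻¹ᵁ V with hU
  set U₂ : (pullback p p).Opens := pullback.fst p p ⁻¹ᵁ U ⊓ pullback.snd p p ⁻¹ᵁ U with hU₂
  let γ : G → (X ⟶ pullback p p) := fun g =>
    pullback.lift (𝟙 X) (σ.aut g).hom (by rw [Category.id_comp, σ.aut_comp])
  haveI : ∀ g, IsOpenImmersion (γ g) := fun g => σ.isOpenImmersion_graph_of_etale g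
  have hγ₁ : ∀ g, γ g ≫ pullback.fst p p = 𝟙 X := fun g => pullback.lift_fst _ _ _
  have hγ₂ : ∀ g, γ g ≫ pullback.snd p p = (σ.aut g).hom := fun g => pullback.lift_snd _ _ _
  -- `γ_g⁻¹ U₂ ≤ U` (indeed `=`), the common target of the two tests
  have hWU : ∀ g, (γ g) ⁻¹ᵁ U₂ ≤ U := fun g => by
    intro x hx
    have hx' : x ∈ (γ g) ⁻¹ᵁ (pullback.fst p p ⁻¹ᵁ U) := hx.1
    rwa [← Scheme.Hom.comp_preimage, hγ₁] at hx'
  have hUg : ∀ g, U ≤ (σ.aut g).hom ⁻¹ᵁ U := fun g => (σ.preimage_preimage g V).ge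
  refine eq_of_forall_appLE_eq_of_subset_iUnion_range γ U₂ (fun z _ => ?_) fun g => ?_
  · exact Set.mem_iUnion.mpr (σ.exists_mem_range_graph_of_transitive htrans z)
  · rw [← CommRingCat.comp_apply, ← CommRingCat.comp_apply, Scheme.Hom.appLE_comp_appLE,
      Scheme.Hom.appLE_comp_appLE, appLE_congr_hom (hγ₁ g) U _ _ (hWU g),
      appLE_congr_hom (hγ₂ g) U _ _ ((hWU g).trans (hUg g))]
    -- left: `(𝟙 X)♯` is restriction; right: `g♯ = restriction ∘ act g⁻¹`
    have hl : Scheme.Hom.appLE (𝟙 X) U ((γ g) ⁻¹ᵁ U₂) (hWU g) = X.presheaf.map (homOfLE (hWU g)).op := by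
      simp only [Scheme.Hom.appLE, Scheme.Hom.id_app, Category.id_comp]
    have hr : (σ.aut g).hom.appLE U ((γ g) ⁻¹ᵁ U₂) ((hWU g).trans (hUg g)) =
        (σ.aut g).hom.appLE U U (hUg g) ≫ X.presheaf.map (homOfLE (hWU g)).op := by
      rw [Scheme.Hom.appLE_map]
    rw [hl, hr, CommRingCat.comp_apply, appLE_aut_hom_eq_act_inv, hs g⁻¹]

/-! ### §4 On affine charts `p♯` is injective with image the invariants -/

/-- **`p♯ : Γ(Q, V) → Γ(X, p⁻¹V)` is injective** on affine `V` for `p` affine, flat and surjective (faithfully flat,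
★ `Morphisms.faithfullyFlat_appLE`). [cite: StacksProject, Tag 023M] [cite: SGA1, Exp. VIII Thm. 1.1] -/
theorem _root_.Literature.AlgebraicGeometry.RelativeSpec.app_injective_of_flat_of_surjective [IsAffineHom p] [Flat p]
    [Surjective p] (V : Q.affineOpens) : Function.Injective (p.app (V : Q.Opens)) := by
  rw [Scheme.Hom.app_eq_appLE]
  exact (faithfullyFlat_appLE p V.2 (V.2.preimage p)).injective

/-- **On an affine `V ⊆ Q` the image of `p♯` is exactly the ring of `G`-invariants of `Γ(X, p⁻¹V)`** (`p` affine étale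
surjective, `G` transitive on geometric fibres): `⊆` is ★ `act_app`; for `⊇`, an invariant `s` has equal cofaces (§3), i.e.
`s ⊗ 1 = 1 ⊗ s` in `Γ(p⁻¹V) ⊗_{Γ(V)} Γ(p⁻¹V) = Γ(X ×_Q X, pr₁⁻¹p⁻¹V)` (★ `exists_ringEquiv_tensorProduct_kernelPair`), so `s`
descends by faithfully flat descent of elements (Mathlib `Algebra.IsEffective.of_faithfullyFlat`, ★ `faithfullyFlat_appLE`).
[cite: SGA1, Exp. VIII Thm. 1.1, Cor. 1.2] [cite: StacksProject, Tag 023M] [cite: MumfordAV1970, §7 Thm. p. 66 (2)] -/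
theorem range_app_eq_setOf_forall_act_eq [IsAffineHom p] [Etale p] [Surjective p]
    (htrans : ∀ (Ω : Type u) [Field Ω] [IsAlgClosed Ω] (x₁ x₂ : Spec (.of Ω) ⟶ X), x₁ ≫ p = x₂ ≫ p →
      ∃ g : G, x₂ = x₁ ≫ (σ.aut g).hom)
    (V : Q.affineOpens) :
    Set.range (p.app (V : Q.Opens)) = {s | ∀ g : G, σ.act g (V : Q.Opens) s = s} := by
  haveI : Flat p := (Etale.iff_flat_and_formallyUnramified.mp inferInstance).1
  have hV : IsAffineOpen (V : Q.Opens) := V.2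
  have hU : IsAffineOpen (p ⁻¹ᵁ (V : Q.Opens)) := V.2.preimage p
  ext s
  constructor
  · rintro ⟨a, rfl⟩ g
    exact σ.act_app g V a
  · intro hs
    letI := (p.appLE (V : Q.Opens) (p ⁻¹ᵁ (V : Q.Opens)) le_rfl).hom.toAlgebra
    haveI : Module.FaithfullyFlat Γ(Q, (V : Q.Opens)) Γ(X, p ⁻¹ᵁ (V : Q.Opens)) :=
      faithfullyFlat_appLE p hV hU
    obtain ⟨e, he₁, he₂⟩ := exists_ringEquiv_tensorProduct_kernelPair p (pullback.fst p p) (pullback.snd p p)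
      (IsPullback.of_hasPullback p p) hV hU
    -- equal cofaces ⇒ `s ⊗ 1 = 1 ⊗ s`
    have hδ := σ.appLE_fst_eq_appLE_snd_of_forall_act_eq htrans V s hs
    have key : s ⊗ₜ[Γ(Q, (V : Q.Opens))] (1 : Γ(X, p ⁻¹ᵁ (V : Q.Opens))) = 1 ⊗ₜ s :=
      e.injective (by rw [he₁, he₂, hδ])
    -- faithfully flat descent of elements
    have hex := (Algebra.IsEffective.of_faithfullyFlat (R := Γ(Q, (V : Q.Opens)))
      (S := Γ(X, p ⁻¹ᵁ (V : Q.Opens))) s).mp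
      (by rw [Algebra.TensorProduct.includeLeftSubRight_apply, key, sub_self])
    obtain ⟨a, ha⟩ := hex
    refine ⟨a, ?_⟩
    rw [Scheme.Hom.app_eq_appLE]
    exact ha

/-! ### §5 HEAD — the recognition -/

/-- **An affine étale surjective `G`-cover whose geometric fibres are `G`-orbits is a geometric quotient of its base**
(SGA 1 V Prop. 2.6, the direction «revêtement galoisien ⇒ quotient»; Mumford §7 Thm. p. 66 (1)+(2) for `Y = X/G`): for a
finite group `G` acting on `X` over `Q` with `p : X → Q` affine, étale and surjective and
`∀ Ω algebraically closed, x₁ ≫ p = x₂ ≫ p → ∃ g, x₂ = x₁ ≫ g` on `Ω`-valued points, `p` is a geometric quotient (★ `ActionOver.IsGeometricQuotient`).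
Recognition ★ `isGeometricQuotient_of_range_app` on the affine opens of `Q` (§4).  No freeness hypothesis.
[cite: SGA1, Exp. V Prop. 2.6, Déf. 2.7] [cite: MumfordAV1970, §7 Thm. p. 66] -/
theorem isGeometricQuotient_of_etale_of_transitive [Finite G] [IsAffineHom p] [Etale p] [Surjective p]
    (htrans : ∀ (Ω : Type u) [Field Ω] [IsAlgClosed Ω] (x₁ x₂ : Spec (.of Ω) ⟶ X), x₁ ≫ p = x₂ ≫ p →
      ∃ g : G, x₂ = x₁ ≫ (σ.aut g).hom) :
    σ.IsGeometricQuotient p :=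
  haveI : Flat p := (Etale.iff_flat_and_formallyUnramified.mp inferInstance).1
  σ.isGeometricQuotient_of_range_app (fun V : Q.affineOpens => V) (iSup_affineOpens_eq_top Q)
    (fun V => app_injective_of_flat_of_surjective V) (fun V => σ.range_app_eq_setOf_forall_act_eq htrans V)

end Literature.AlgebraicGeometry.RelativeSpec.ActionOver

end
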